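import Mathlib

/-!
# Route OverlapGapAlgebra, crux `SolvableImpliesStableSection` (stmt-PneNP-2463), line `Sketch`:
# Stub 3 `stub_goodWalk` — a harmless walk from a good start is good everywhere

We consider the lazy coordinate-resampling walk on `J → S` (Bresler–Huang, arXiv:2106.02129, §6.2):
`pos v U t` is the position after `t` steps, characterised only by `hpos0` (the walk starts at `v`)
and `hposS` (step `t < T` overwrites coordinate `σ t` with the fresh symbol `U t`).  A step is *lazy*
when the fresh symbol equals the current one (`U t = pos v U t (σ t)`, so the walk does not move, by
`Function.update_eq_self`); otherwise we assume its edge is not bad, where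
`Bad v w ↔ ¬ InG v ∨ ¬ InG w ∨ D v w` and `D` is irreflexive.

**Claim (`stub_goodWalk`).** If the start `v` lies in `InG` and every step is lazy or not bad, then
every position at a time `t ≤ T` lies in `InG` and no step `t < T` is a `D`-jump.

**Proof.** A one-step lemma: from a position in `InG` at time `t < T`, the next position is in `InG`
and the step is no `D`-jump — a lazy step does not move (so `InG` persists and `¬ D` is
irreflexivity), and for a non-bad step all three disjuncts of `Bad` fail.  The invariant
`t ≤ T → InG (pos v U t)` then follows by induction on `t`, and the second conjunct from the one-step
lemma applied to the invariant.
-/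

set_option linter.dupNamespace false

namespace Summit.PneNP.PneNP.Cruxes.SolvableImpliesStableSection.Sketch

open Finset
open scoped Classical

/-- **Stub 3 — a harmless walk from a good start is good everywhere.**
For the lazy resampling walk `pos v U` (start `v` by `hpos0`, step `t < T` overwrites coordinate
`σ t` with `U t` by `hposS`): if `InG v` and every step is lazy (`U t = pos v U t (σ t)`) or not
`Bad` (where `Bad v w ↔ ¬ InG v ∨ ¬ InG w ∨ D v w`, `D` irreflexive), then every position at a time
`t ≤ T` is in `InG` and no step `t < T` is a `D`-jump.  Proof: one-step lemma (lazy steps do not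
move, `Function.update_eq_self`; non-bad steps negate all three disjuncts), then induction on `t`. -/
theorem stub_goodWalk {S J : Type*} [DecidableEq J] (T : ℕ) (σ : Fin T → J)
    (InG : (J → S) → Prop) (D Bad : (J → S) → (J → S) → Prop)
    (hBad : ∀ v w, Bad v w ↔ (¬ InG v ∨ ¬ InG w ∨ D v w)) (hD : ∀ w, ¬ D w w)
    (pos : (J → S) → (Fin T → S) → ℕ → (J → S))
    (hpos0 : ∀ v U, pos v U 0 = v)
    (hposS : ∀ v U (t : Fin T), pos v U ((t : ℕ) + 1) = Function.update (pos v U t) (σ t) (U t))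
    (v : J → S) (U : Fin T → S) (hv : InG v)
    (hno : ∀ t : Fin T, U t = pos v U t (σ t) ∨ ¬ Bad (pos v U t) (pos v U ((t : ℕ) + 1))) :
    (∀ t : ℕ, t ≤ T → InG (pos v U t)) ∧ ∀ t : ℕ, t < T → ¬ D (pos v U t) (pos v U (t + 1)) := by
  -- one step of the walk: from a good position at time `t < T`, the next position is good and the
  -- step is no `D`-jump
  have hstep : ∀ t : ℕ, t < T → InG (pos v U t) →
      InG (pos v U (t + 1)) ∧ ¬ D (pos v U t) (pos v U (t + 1)) := by
    intro t ht hG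
    have h : U ⟨t, ht⟩ = pos v U t (σ ⟨t, ht⟩) ∨ ¬ Bad (pos v U t) (pos v U (t + 1)) :=
      hno ⟨t, ht⟩
    rcases h with hlazy | hgood
    · -- lazy step: the walk does not move
      have hS : pos v U (t + 1) = pos v U t := by
        have hS' : pos v U (t + 1) = Function.update (pos v U t) (σ ⟨t, ht⟩) (U ⟨t, ht⟩) :=
          hposS v U ⟨t, ht⟩
        rw [hS', hlazy, Function.update_eq_self]
      rw [hS]
      exact ⟨hG, hD _⟩
    · -- non-bad step: all three disjuncts of `Bad` fail
      rw [hBad] at hgood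
      simp only [not_or, not_not] at hgood
      exact ⟨hgood.2.1, hgood.2.2⟩
  -- the invariant `InG (pos v U t)` for all `t ≤ T`, by induction on `t`
  have hinv : ∀ t : ℕ, t ≤ T → InG (pos v U t) := by
    intro t
    induction t with
    | zero =>
      intro _
      rw [hpos0]
      exact hv
    | succ n ih =>
      intro hn
      exact (hstep n (Nat.lt_of_succ_le hn) (ih (Nat.le_of_succ_le hn))).1
  exact ⟨hinv, fun t ht => (hstep t ht (hinv t ht.le)).2⟩

end Summit.PneNP.PneNP.Cruxes.SolvableImpliesStableSection.Sketch
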